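import Summits.MatrixMultiplication.MatrixMultiplication.Theorems.ThinPackings.Negative.FrameVolumeExcess
import Summits.MatrixMultiplication.MatrixMultiplication.Theorems.ThinPackings.Negative.MultiRadiusFramesNecessary

/-!
# Any linear volume bound kills the frame design stubs (crux `ThinPackings`, stmt-MatrixMultiplication-10595)

Lead c2 (line `three-sphere-frame-designs`, 2026-08-16).  Lead a1's kill criterion (`FrameVolumeExcess.lean`)
reads: `FrameNoExcess` (`Σᵢ |Aᵢ||Bᵢ||Cᵢ| ≤ (6b+1)^D` for every T/E/F-packed orthogonal-frame family in
`[-b,b]^D`) refutes both registered design stubs, because a design at `(a, η)` with `η < a` has volume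
`> (6b+1)^D`.  This file records that MUCH LESS is needed.  The design stubs quantify over ALL `a < 1` and
`η > 0`; instantiated at `(a, η) = (1 − ε, ε)` with `ε = 1/(n+2)`, the two-leg count `(6b+1)^D ≤ L·N^{2+η}`
and the tile-box necessity `(7/5)^D ≤ N^η` (`frames_slack_lower_bound`, Disproof §4 / p84355) force

  `Σᵢ |Aᵢ||Bᵢ||Cᵢ| = L·N²·M ≥ L·N^{2+ε}·N^{1−2ε} ≥ (6b+1)^D · ((7/5)^n)^D`,

an excess RATIO that is an arbitrarily large exponential in `D`.  Hence (`not_sphereFrameDesigns_of_weakNoExcess`,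
`not_generalFrameDesigns_of_weakNoExcess`): for every constant `K ≥ 1`, the bound
`WeakNoExcess K : Σᵢ |Aᵢ||Bᵢ||Cᵢ| ≤ (K·(6b+1))^D` already refutes BOTH stubs.  The honest open question behind
the Euclidean-frame programme is therefore not the sharp constant `6b+1` but whether the frame volume capacity
`Θ_b = sup_D V*(D,b)^{1/D}` is `O(b)` at all (known: `3.78 b ≤ Θ_b ≤ (4b+1)(2b+1)^{1/3}`; `Θ₁ ≤ 6.97`,
`FrameNoExcessOne.lean`; coordinate frames `≤ 6b+1`, `CoordinateFrameNoExcess.lean`).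
Elementary and sorry-free. -/

set_option linter.dupNamespace false  -- `Summit.<S>.<S>.…` is the mandated namespace

namespace Summit.MatrixMultiplication.MatrixMultiplication.Theorems.ThinPackings.Negative

open Finset

/-- **WeakNoExcess K**: every orthogonal-frame family in a box `[-b,b]^D` with the three weak packings has total
block volume at most `(K·(6b+1))^D`.  `WeakNoExcess 1` is `FrameNoExcess`; the kill of the frame design stubs
needs it only for SOME constant `K`. [new — a family of conjectures, open for every K] -/
def WeakNoExcess (K : ℝ) : Prop :=
  ∀ (D L b : ℕ) (A B C : Fin L → Finset (Fin D → ℤ)),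
    (∀ i, (∀ v ∈ A i, ∀ t, |v t| ≤ (b : ℤ)) ∧ (∀ v ∈ B i, ∀ t, |v t| ≤ (b : ℤ)) ∧
      (∀ v ∈ C i, ∀ t, |v t| ≤ (b : ℤ))) →
    ((∀ i, ∀ x ∈ A i, ∀ y ∈ B i, x ⬝ᵥ y = 0) ∧ (∀ i, ∀ x ∈ A i, ∀ z ∈ C i, x ⬝ᵥ z = 0) ∧
      (∀ i, ∀ y ∈ B i, ∀ z ∈ C i, y ⬝ᵥ z = 0)) →
    (∀ i k, ∀ x ∈ A i, ∀ z ∈ C i, ∀ x' ∈ A k, ∀ z' ∈ C k, z - x = z' - x' → i = k) →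
    (∀ i k, ∀ x ∈ A i, ∀ y ∈ B i, ∀ x' ∈ A k, ∀ y' ∈ B k, y - x = y' - x' → i = k) →
    (∀ i k, ∀ y ∈ B i, ∀ z ∈ C i, ∀ y' ∈ B k, ∀ z' ∈ C k, y - z = y' - z' → i = k) →
    ((∑ i, (A i).card * (B i).card * (C i).card : ℕ) : ℝ) ≤ (K * (6 * b + 1)) ^ D

/-- `FrameNoExcess` is `WeakNoExcess 1`. [new, elementary] -/
theorem weakNoExcess_one_of_frameNoExcess (h : FrameNoExcess) : WeakNoExcess 1 := by
  intro D L b A B C hbox hfr hPD hPE hPF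
  have := h D L b A B C hbox hfr hPD hPE hPF
  rw [one_mul]
  exact_mod_cast this

/-- **The volume a design must carry.**  Core estimate, stated on the conjuncts the two stubs share: box legs
with the T-packing (strong form), cards `N, M, N` with `2 ≤ N`, `N^{1−ε} ≤ M` and the count
`(6b+1)^D ≤ L·N^{2+ε}` at `ε = 1/(n+2)` give `((7/5)^n·(6b+1))^D ≤ L·N²·M` and `1 ≤ D`. [new, elementary] -/
theorem design_volume_lower_bound {D L b N M n : ℕ} {A B C : Fin L → Finset (Fin D → ℤ)}
    (hST : ∀ i k, ∀ a ∈ A i, ∀ c ∈ C i, ∀ a' ∈ A k, ∀ c' ∈ C k,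
      c - a = c' - a' → i = k ∧ a = a' ∧ c = c')
    (hbA : ∀ i, ∀ v ∈ A i, ∀ t, |v t| ≤ (b : ℤ)) (hbC : ∀ i, ∀ v ∈ C i, ∀ t, |v t| ≤ (b : ℤ))
    (hcard : ∀ i, (A i).card = N ∧ (B i).card = M ∧ (C i).card = N) (hN : 2 ≤ N)
    (hM : (N : ℝ) ^ (1 - 1 / ((n : ℝ) + 2)) ≤ M)
    (hcount : (((6 * b + 1 : ℕ) : ℝ)) ^ D ≤ L * (N : ℝ) ^ (2 + 1 / ((n : ℝ) + 2))) :
    (((7 : ℝ) / 5) ^ n * ((6 * b + 1 : ℕ) : ℝ)) ^ D ≤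
        ((∑ i, (A i).card * (B i).card * (C i).card : ℕ) : ℝ) ∧ 1 ≤ D := by
  set ε : ℝ := 1 / ((n : ℝ) + 2) with hε
  have hεpos : 0 < ε := by rw [hε]; positivity
  have hN1 : (1 : ℝ) < N := by exact_mod_cast (by omega : 1 < N)
  have hNpos : (0 : ℝ) < N := by linarith
  obtain ⟨-, hb1, hslack⟩ := frames_slack_lower_bound hST hbA hbC (fun i => (hcard i).1)
    (fun i => (hcard i).2.2) hN hcount
  -- `1 ≤ D`: in dimension 0 a leg has at most one point, contradicting `2 ≤ N`
  have hL : 1 ≤ L := by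
    by_contra hL0
    have hL0 : L = 0 := by omega
    rw [hL0, Nat.cast_zero, zero_mul] at hcount
    have : (0 : ℝ) < (((6 * b + 1 : ℕ) : ℝ)) ^ D := by positivity
    linarith
  have hD : 1 ≤ D := by
    by_contra hD0
    have hD0 : D = 0 := by omega
    subst hD0
    have i : Fin L := ⟨0, hL⟩
    have hsub : (A i).card ≤ 1 :=
      Finset.card_le_one.mpr fun a _ b _ => Subsingleton.elim a b
    have := (hcard i).1
    omega
  refine ⟨?_, hD⟩
  -- volume identity and the chain of real-power estimates
  rw [sum_volume_eq_of_cards A B C hcard]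
  have hcast : (((L * (N ^ 2 * M) : ℕ)) : ℝ) = (L : ℝ) * ((N : ℝ) ^ 2 * M) := by push_cast; ring
  rw [hcast]
  have h12 : (1 : ℝ) - 2 * ε = ε * n := by
    rw [hε]; field_simp; ring
  have hslack' : (((7 : ℝ) / 5) ^ n) ^ D ≤ (N : ℝ) ^ (1 - 2 * ε) := by
    rw [h12, Real.rpow_mul_natCast hNpos.le, ← pow_mul, mul_comm, pow_mul]
    exact pow_le_pow_left₀ (by positivity) hslack n
  have hvol : (L : ℝ) * (N : ℝ) ^ (2 + ε) * (N : ℝ) ^ (1 - 2 * ε) ≤ L * ((N : ℝ) ^ 2 * M) := by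
    have hsplit : (N : ℝ) ^ (2 + ε) * (N : ℝ) ^ (1 - 2 * ε) = (N : ℝ) ^ 2 * (N : ℝ) ^ (1 - ε) := by
      rw [← Real.rpow_add hNpos, ← Real.rpow_two, ← Real.rpow_add hNpos]; ring_nf
    rw [mul_assoc, hsplit]
    have hL0 : (0 : ℝ) ≤ L := Nat.cast_nonneg L
    have hN2 : (0 : ℝ) ≤ (N : ℝ) ^ 2 := by positivity
    have hM' : (N : ℝ) ^ (1 - ε) ≤ M := by rw [hε]; exact hM
    exact mul_le_mul_of_nonneg_left (mul_le_mul_of_nonneg_left hM' hN2) hL0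
  calc (((7 : ℝ) / 5) ^ n * ((6 * b + 1 : ℕ) : ℝ)) ^ D
      = (((6 * b + 1 : ℕ) : ℝ)) ^ D * (((7 : ℝ) / 5) ^ n) ^ D := by rw [mul_pow]; ring
    _ ≤ (L * (N : ℝ) ^ (2 + ε)) * (N : ℝ) ^ (1 - 2 * ε) :=
        mul_le_mul hcount hslack' (by positivity) (by positivity)
    _ = (L : ℝ) * (N : ℝ) ^ (2 + ε) * (N : ℝ) ^ (1 - 2 * ε) := by ring
    _ ≤ L * ((N : ℝ) ^ 2 * M) := hvol

/-- From `((7/5)^n·(6b+1))^D ≤ Σ ≤ (K·(6b+1))^D` with `1 ≤ D`: `(7/5)^n ≤ K`. [new, elementary] -/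
theorem pow_le_of_volume_sandwich {D b n : ℕ} {K S : ℝ} (hD : 1 ≤ D)
    (hlow : (((7 : ℝ) / 5) ^ n * ((6 * b + 1 : ℕ) : ℝ)) ^ D ≤ S)
    (hup : S ≤ (K * (6 * b + 1)) ^ D) (hK : 0 ≤ K) : ((7 : ℝ) / 5) ^ n ≤ K := by
  have hm : (0 : ℝ) < ((6 * b + 1 : ℕ) : ℝ) := by positivity
  have h : (((7 : ℝ) / 5) ^ n * ((6 * b + 1 : ℕ) : ℝ)) ^ D ≤ (K * ((6 * b + 1 : ℕ) : ℝ)) ^ D := by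
    have e : K * ((6 * b + 1 : ℕ) : ℝ) = K * (6 * b + 1) := by push_cast; ring
    rw [e]; exact hlow.trans hup
  rw [pow_le_pow_iff_left₀ (by positivity) (by positivity) (by omega)] at h
  exact le_of_mul_le_mul_right h hm

/-- **Kill reduction, sphere line, weak form.**  `WeakNoExcess K` for ANY constant `K ≥ 1` refutes the design
stub `stub_frameDesign` (`SphereFrameDesigns`): instantiate the stub at `(a, η) = (1 − 1/(n+2), 1/(n+2))`
with `(7/5)^n > K`. [new, elementary] -/
theorem not_sphereFrameDesigns_of_weakNoExcess {K : ℝ} (hK1 : 1 ≤ K) (hW : WeakNoExcess K) :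
    ¬ SphereFrameDesigns := by
  intro h
  obtain ⟨n, hn⟩ := pow_unbounded_of_one_lt K (by norm_num : (1 : ℝ) < 7 / 5)
  have hε0 : (0 : ℝ) < 1 / ((n : ℝ) + 2) := by positivity
  have hε1 : 1 / ((n : ℝ) + 2) ≤ 1 / 2 := by
    rw [div_le_div_iff₀ (by positivity) (by norm_num)]; linarith [(Nat.cast_nonneg n : (0 : ℝ) ≤ n)]
  obtain ⟨D, R, L, N, M, rA, rB, rC, A, B, C, hbA, hbB, hbC, -, -, -, hoAB, hoAC, hoBC, hPD, hPE, hPF, -,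
    hcard, hN, hM, hH⟩ := h (1 - 1 / ((n : ℝ) + 2)) (by linarith) (by linarith) (1 / ((n : ℝ) + 2)) hε0
  have hH' : (((6 * R + 1 : ℕ) : ℝ)) ^ D ≤ L * (N : ℝ) ^ (2 + 1 / ((n : ℝ) + 2)) := by
    have : ((((6 * R + 1) ^ D : ℕ)) : ℝ) = (((6 * R + 1 : ℕ) : ℝ)) ^ D := by push_cast; ring
    rw [← this]; exact hH
  have hST := strong_packing_of_weak A C hoAC hPD
  obtain ⟨hlow, hD⟩ := design_volume_lower_bound hST hbA hbC hcard hN hM hH'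
  have hup := hW D L R A B C (fun i => ⟨hbA i, hbB i, hbC i⟩) ⟨hoAB, hoAC, hoBC⟩ hPD hPE hPF
  have := pow_le_of_volume_sandwich hD hlow hup (by linarith)
  linarith

/-- **Kill reduction, label-weighted line, weak form.**  `WeakNoExcess K` for any `K ≥ 1` also refutes
`stub_generalFrameDesigns` (verbatim; only the frame, box, packing, cardinality and count conjuncts are used).
[new, elementary] -/
theorem not_generalFrameDesigns_of_weakNoExcess {K : ℝ} (hK1 : 1 ≤ K) (hW : WeakNoExcess K) :
    ¬ (∀ a : ℝ, 0 ≤ a → a < 1 → ∀ η : ℝ, 0 < η →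
      ∃ (D L N M b R : ℕ) (A B C : Fin L → Finset (Fin D → ℤ)) (rA rB rC κ μ : Fin L → ℤ),
        ((∀ i, ∀ x ∈ A i, ∀ y ∈ B i, x ⬝ᵥ y = 0) ∧ (∀ i, ∀ x ∈ A i, ∀ z ∈ C i, x ⬝ᵥ z = 0) ∧
          (∀ i, ∀ y ∈ B i, ∀ z ∈ C i, y ⬝ᵥ z = 0)) ∧
        ((∀ i, ∀ x ∈ A i, x ⬝ᵥ x = rA i) ∧ (∀ i, ∀ y ∈ B i, y ⬝ᵥ y = rB i) ∧
          (∀ i, ∀ z ∈ C i, z ⬝ᵥ z = rC i)) ∧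
        ((∀ i k, rA k + rB k < rA i + rB i → κ k + 1 ≤ κ i) ∧
          (∀ i k, rB k + rC k < rB i + rC i → μ k + 1 ≤ μ i) ∧
          (∀ i k, rA i + rC i < rA k + rC k → κ k + μ k + 1 ≤ κ i + μ i)) ∧
        ((∀ i k, ∀ a ∈ A i, ∀ c ∈ C i, ∀ a' ∈ A k, ∀ c' ∈ C k, c - a = c' - a' → i = k ∧ a = a' ∧ c = c') ∧
         (∀ i k, ∀ a ∈ A i, ∀ b ∈ B i, ∀ a' ∈ A k, ∀ b' ∈ B k, b - a = b' - a' → i = k ∧ a = a' ∧ b = b') ∧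
         (∀ i k, ∀ b ∈ B i, ∀ c ∈ C i, ∀ b' ∈ B k, ∀ c' ∈ C k, b - c = b' - c' → i = k ∧ b = b' ∧ c = c') ∧
         (∀ i j k : Fin L, i ≠ j → j ≠ k → i ≠ k → (κ i - κ k) + (μ j - μ k) ≤ 0 →
            ∀ s ∈ A k, ∀ s' ∈ A i, ∀ t ∈ B i, ∀ t' ∈ B j, ∀ u ∈ C j, ∀ u' ∈ C k,
              (s' - s) + (t' - t) + (u' - u) ≠ 0)) ∧
        (∀ i, (A i).card = N ∧ (B i).card = M ∧ (C i).card = N) ∧ 2 ≤ N ∧ (N : ℝ) ^ a ≤ M ∧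
        (∀ i, (∀ v ∈ A i, ∀ t, |v t| ≤ (b : ℤ)) ∧ (∀ v ∈ B i, ∀ t, |v t| ≤ (b : ℤ)) ∧
          (∀ v ∈ C i, ∀ t, |v t| ≤ (b : ℤ))) ∧
        (∀ i, |κ i| ≤ (R : ℤ) ∧ |μ i| ≤ (R : ℤ)) ∧
        (((6 * b + 1 : ℕ) : ℝ)) ^ D ≤ L * (N : ℝ) ^ (2 + η)) := by
  intro h
  obtain ⟨n, hn⟩ := pow_unbounded_of_one_lt K (by norm_num : (1 : ℝ) < 7 / 5)
  have hε0 : (0 : ℝ) < 1 / ((n : ℝ) + 2) := by positivity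
  have hε1 : 1 / ((n : ℝ) + 2) ≤ 1 / 2 := by
    rw [div_le_div_iff₀ (by positivity) (by norm_num)]; linarith [(Nat.cast_nonneg n : (0 : ℝ) ≤ n)]
  obtain ⟨D, L, N, M, b, R, A, B, C, rA, rB, rC, κ, μ, hfr, -, -, ⟨hR1, hR2, hR3, -⟩, hcard, hN, hM, hbox,
    -, hcount⟩ := h (1 - 1 / ((n : ℝ) + 2)) (by linarith) (by linarith) (1 / ((n : ℝ) + 2)) hε0
  obtain ⟨hlow, hD⟩ := design_volume_lower_bound hR1 (fun i => (hbox i).1) (fun i => (hbox i).2.2)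
    hcard hN hM hcount
  have hup := hW D L b A B C hbox hfr
    (fun i k x hx z hz x' hx' z' hz' he => (hR1 i k x hx z hz x' hx' z' hz' he).1)
    (fun i k x hx y hy x' hx' y' hy' he => (hR2 i k x hx y hy x' hx' y' hy' he).1)
    (fun i k y hy z hz y' hy' z' hz' he => (hR3 i k y hy z hz y' hy' z' hz' he).1)
  have := pow_le_of_volume_sandwich hD hlow hup (by linarith)
  linarith

end Summit.MatrixMultiplication.MatrixMultiplication.Theorems.ThinPackings.Negative
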